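import Summits.ResolutionOfSingularities.ResolutionOfSingularities.Theorems.PowerLiftTransport

/-!
# PowerLiftRoot — slice 4/4 of decomp-res lens-5 g42 «PowerLift» (PIN `PowerLift.lean` sha256 1772eef3, 746 l), §5 BY NAME: the weight axis of the root and of its marking-free binders; roots `noForcedTowers_of_g49` / `_g49h` / `_g49_residual` / `_g49_deep`
(monolith lines 530–744); sliced by the writer (g16) at the lens's own cut points for the ≤ 400-line rule (cn41) — declarations,
docstrings and proofs byte-verbatim; only this module docstring, the import of the previous slice and the repeated file header
(`noncomputable section`, `set_option linter.dupNamespace false`, the `open`s, the namespace) are added.  The mathematical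
overview, sources and compliance notes are in the module docstring of slice 1 (`Theorems/PowerLift.lean`).
-/

noncomputable section

set_option linter.dupNamespace false

open CategoryTheory CategoryTheory.Limits AlgebraicGeometry TopologicalSpace IsLocalRing
open Literature.AlgebraicGeometry.Resolution
open Summit.ResolutionOfSingularities.ResolutionOfSingularities.Theorems
open WeakOrderReduction ForcedTowerClasses DivergentTowerClasses MonomialTowerClasses
open HugDimensionClasses HugDimensionKernels SurfaceShadowClasses SurfaceShadowKernels

namespace Summit.ResolutionOfSingularities.ResolutionOfSingularities.Theorems.HugValuationCut

/-! ## §5 BY NAME: the weight axis of the root and of its marking-free binders -/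

section ByName

open Summit.ResolutionOfSingularities.ResolutionOfSingularities.Theses

variable {k : Type} [Field k]

/-- **30253 at the WILD WEIGHTS only**: «no infinite forced tower of weight `n` when `p ∣ n`», all `n ≥ 1`. -/
def NoForcedTowersAtWildWeights : Prop := ∀ n : ℕ, 1 ≤ n → NoTowerWild n fun _ => True

/-- **31571 at the WILD WEIGHTS only**: the contact column restricted to `p ∣ n`. -/
def NoContactHuggingTowersAtWildWeights : Prop := ∀ n : ℕ, 1 ≤ n → NoTowerWild n ContactHugging

/-- **31570 at the WILD WEIGHTS only**. -/
def NoHuggingTowersAtWildWeights : Prop := ∀ n : ℕ, 1 ≤ n → NoTowerWild n GermHugging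

/-- **31572 at the WILD WEIGHTS only** (`Wild` in 31572's name = no permanent contact; here the WEIGHT is wild too). -/
def NoWildHuggingTowersAtWildWeights : Prop :=
  ∀ n : ℕ, 1 ≤ n → NoTowerWild n fun T => GermHugging T ∧ ¬ ContactHugging T

/-- **the shadow port at the wild weights only** (`p ∣ n`). -/
def ShadowPortWild (n : ℕ) : Prop :=
  ∀ p : ℕ, p.Prime → p ∣ n → ∀ (k : Type) [Field k] [CharP k p] (T : ForcedTower) (g : T.St 0 ⟶ Spec (.of k)),
    IsBase (T.St 0) g → IsDatum n (T.D 0) → (T.D 0).boundary = [] → ¬ CurveHugging T → SurfaceHugging T →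
      Nonempty (HugShadow T)

/-- **the marking port at the wild weights only** (`p ∣ n`). -/
def MarkingPortWild (n : ℕ) : Prop :=
  ∀ p : ℕ, p.Prime → p ∣ n → ∀ (k : Type) [Field k] [CharP k p] (T : ForcedTower) (g : T.St 0 ⟶ Spec (.of k)),
    IsBase (T.St 0) g → IsDatum n (T.D 0) → (T.D 0).boundary = [] → ∀ S : HugShadow T, S.OffLocus →
      Nonempty (MarkedShadow T n)

/-- `ShadowPortWild n` for all `n ≥ 1`. -/
def ShadowPortAtWildWeights : Prop := ∀ n : ℕ, 1 ≤ n → ShadowPortWild n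

/-- `MarkingPortWild n` for all `n ≥ 1`. -/
def MarkingPortAtWildWeights : Prop := ∀ n : ℕ, 1 ≤ n → MarkingPortWild n

/-- **hH at the WILD WEIGHTS only**: the `w = 3` residual leaf (never monomial, no curve, no surface hugged)
restricted to `p ∣ n`. -/
def NoHypersurfaceHuggingTowersAtWildWeights : Prop :=
  ∀ n : ℕ, 1 ≤ n → NoTowerWild n fun T => ¬ EventuallyMonomial T ∧ ¬ CurveHugging T ∧ ¬ SurfaceHugging T

/-- the `w = 2` residual leaf `SurfaceHuggingTowersTerminate` restricted to `p ∣ n`, all `n ≥ 1`. -/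
def NoSurfaceLeafTowersAtWildWeights : Prop :=
  ∀ n : ℕ, 1 ≤ n → NoTowerWild n fun T => ¬ EventuallyMonomial T ∧ ¬ CurveHugging T ∧ SurfaceHugging T

/-- **EXACT (30253): `MaxContactCut.NoForcedTowers ⟺ NoForcedTowersAtWildWeights`** — infinite forced towers exist iff
they exist at a weight divisible by the characteristic. [folklore] -/
theorem noForcedTowers_iff_atWildWeights : MaxContactCut.NoForcedTowers ↔ NoForcedTowersAtWildWeights :=
  (forall₂_congr fun _ _ => forcedTowersTerminate_iff_noTower).trans (noTower_all_iff_wild powStable_true)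

/-- **EXACT (30253), every depth `J`: `MaxContactCut.NoForcedTowers ⟺ ∀ n ≥ 1, NoTowerDeep J n ⊤`** — only the weights with
`v_p(n) ≥ J` matter, for every `J`. [folklore] -/
theorem noForcedTowers_iff_deep (J : ℕ) :
    MaxContactCut.NoForcedTowers ↔ ∀ n : ℕ, 1 ≤ n → NoTowerDeep J n fun _ => True :=
  (forall₂_congr fun _ _ => forcedTowersTerminate_iff_noTower).trans (noTower_all_iff_deep J powStable_true)

/-- **EXACT (31571): `MaxContactCut.NoContactHuggingTowers ⟺ NoContactHuggingTowersAtWildWeights`** — the TAME contact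
column is redundant. [folklore] -/
theorem noContactHuggingTowers_iff_atWildWeights :
    MaxContactCut.NoContactHuggingTowers ↔ NoContactHuggingTowersAtWildWeights :=
  noTower_all_iff_wild powInvariant_contactHugging.stable

/-- EXACT (31571), every depth `J`. [folklore] -/
theorem noContactHuggingTowers_iff_deep (J : ℕ) :
    MaxContactCut.NoContactHuggingTowers ↔ ∀ n : ℕ, 1 ≤ n → NoTowerDeep J n ContactHugging :=
  noTower_all_iff_deep J powInvariant_contactHugging.stable

/-- **EXACT (31570): `MaxContactCut.NoHuggingTowers ⟺ NoHuggingTowersAtWildWeights`.** [folklore] -/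
theorem noHuggingTowers_iff_atWildWeights : MaxContactCut.NoHuggingTowers ↔ NoHuggingTowersAtWildWeights :=
  noTower_all_iff_wild powInvariant_germHugging.stable

/-- **EXACT (31572): `MaxContactCut.NoWildHuggingTowers ⟺ NoWildHuggingTowersAtWildWeights`.** [folklore] -/
theorem noWildHuggingTowers_iff_atWildWeights :
    MaxContactCut.NoWildHuggingTowers ↔ NoWildHuggingTowersAtWildWeights :=
  noTower_all_iff_wild (powInvariant_germHugging.and powInvariant_contactHugging.not).stable

/-- restriction. [folklore] -/
theorem shadowPortWild_of_shadowPort {n : ℕ} (h : ShadowPort n) : ShadowPortWild n :=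
  fun p hp _ k _ _ T g hB hD hE hC hS => h p hp k T g hB hD hE hC hS

/-- restriction. [folklore] -/
theorem markingPortWild_of_markingPort {n : ℕ} (h : MarkingPort n) : MarkingPortWild n :=
  fun p hp _ k _ _ T g hB hD hE S hS => h p hp k T g hB hD hE S hS

/-- **`ShadowPort (a·n) → ShadowPort n`** (`a ≥ 1`): hug shadows of `T^a` descend. [folklore] -/
theorem shadowPort_of_mul {n a : ℕ} (ha : 0 < a) (h : ShadowPort (a * n)) : ShadowPort n := by
  intro p hp k _ _ T g hB hD hE hC hS
  obtain ⟨S⟩ := h p hp k (powTower T a (powTower_hiso T g hB ha) (powTower_htr T g hB hD a)) g hB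
    (powTower_isDatum T g hB hD a _ _) hE (fun h' => hC (curveHugging_powTower_iff.mp h'))
    (surfaceHugging_powTower_iff.mpr hS)
  exact ⟨S.ofPow⟩

/-- **`MarkingPort ((b+1)·n) → MarkingPort n`**: marked shadows of `T^{b+1}` descend, reweighted. [folklore] -/
theorem markingPort_of_mul {n b : ℕ} (h : MarkingPort ((b + 1) * n)) : MarkingPort n := by
  intro p hp k _ _ T g hB hD hE S hS
  obtain ⟨M⟩ := h p hp k (powTower T (b + 1) (powTower_hiso T g hB b.succ_pos) (powTower_htr T g hB hD (b + 1))) g hB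
    (powTower_isDatum T g hB hD (b + 1) _ _) hE (S.toPow (b + 1) _ _) ((S.offLocus_toPow_iff b.succ_pos).mpr hS)
  exact ⟨M.ofPow⟩

/-- **EXACT: `ShadowPortAll ⟺ ShadowPortAtWildWeights`.** [folklore] -/
theorem shadowPortAll_iff_atWildWeights : ShadowPortAll ↔ ShadowPortAtWildWeights := by
  refine ⟨fun h n hn => shadowPortWild_of_shadowPort (h n hn), fun h n hn p hp k _ _ T g hB hD hE hC hS => ?_⟩
  obtain ⟨S⟩ := h (p * n) (le_trans hn (Nat.le_mul_of_pos_left n hp.pos)) p hp (dvd_mul_right p n) k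
    (powTower T p (powTower_hiso T g hB hp.pos) (powTower_htr T g hB hD p)) g hB (powTower_isDatum T g hB hD p _ _) hE
    (fun h' => hC (curveHugging_powTower_iff.mp h')) (surfaceHugging_powTower_iff.mpr hS)
  exact ⟨S.ofPow⟩

/-- **EXACT: `MarkingPortAll ⟺ MarkingPortAtWildWeights`.** [folklore] -/
theorem markingPortAll_iff_atWildWeights : MarkingPortAll ↔ MarkingPortAtWildWeights := by
  refine ⟨fun h n hn => markingPortWild_of_markingPort (h n hn), fun h n hn p hp k _ _ T g hB hD hE S hS => ?_⟩
  obtain ⟨b, hb⟩ : ∃ b : ℕ, p = b + 1 := ⟨p - 1, (Nat.sub_add_cancel hp.one_le).symm⟩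
  have hN : 1 ≤ (b + 1) * n := le_trans hn (Nat.le_mul_of_pos_left n b.succ_pos)
  have hdvd : p ∣ (b + 1) * n := by rw [hb]; exact dvd_mul_right _ _
  obtain ⟨M⟩ := h ((b + 1) * n) hN p hp hdvd k
    (powTower T (b + 1) (powTower_hiso T g hB b.succ_pos) (powTower_htr T g hB hD (b + 1))) g hB
    (powTower_isDatum T g hB hD (b + 1) _ _) hE (S.toPow (b + 1) _ _) ((S.offLocus_toPow_iff b.succ_pos).mpr hS)
  exact ⟨M.ofPow⟩

/-! ### Modulo the monomial port `hMo`: the never-monomial leaves, `hH` included -/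

/-- **the monomial class at every weight from the port `hMo` ALONE** — the combinatorial leaf `NoCornerTower d n`,
`d ≤ 4`, is the tree's theorem `CornerTowerDynamics.noCornerTowers_tree`. [folklore] -/
theorem monomialTowersTerminate_of_cornerAll (hMo : MaxContactCut.MonomialCornerAll) :
    ∀ N : ℕ, 1 ≤ N → MonomialTowersTerminate N :=
  fun N hN => monomial_of_ports (hMo N hN) (CornerTowerDynamics.noCornerTowers_tree N hN)

/-- **EXACT modulo `hMo`: `MaxContactCut.NoHypersurfaceHuggingTowers ⟺ NoHypersurfaceHuggingTowersAtWildWeights`** — the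
binder `hH` of the root may be restricted to the weights divisible by `p` as well. [folklore] -/
theorem noHypersurfaceHuggingTowers_iff_atWildWeights (hMo : MaxContactCut.MonomialCornerAll) :
    MaxContactCut.NoHypersurfaceHuggingTowers ↔ NoHypersurfaceHuggingTowersAtWildWeights :=
  noTower_nonMonomial_all_iff_wild (Q := fun T => ¬ CurveHugging T ∧ ¬ SurfaceHugging T)
    (powInvariant_curveHugging.not.and powInvariant_surfaceHugging.not).stable
    (monomialTowersTerminate_of_cornerAll hMo)

/-- EXACT modulo `hMo`, every depth `J`: `hH ⟺` its depth-`J` column. [folklore] -/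
theorem noHypersurfaceHuggingTowers_iff_deep (J : ℕ) (hMo : MaxContactCut.MonomialCornerAll) :
    MaxContactCut.NoHypersurfaceHuggingTowers ↔ ∀ n : ℕ, 1 ≤ n →
      NoTowerDeep J n fun T => ¬ EventuallyMonomial T ∧ ¬ CurveHugging T ∧ ¬ SurfaceHugging T :=
  noTower_nonMonomial_all_iff_deep J (Q := fun T => ¬ CurveHugging T ∧ ¬ SurfaceHugging T)
    (powInvariant_curveHugging.not.and powInvariant_surfaceHugging.not).stable
    (monomialTowersTerminate_of_cornerAll hMo)

/-- EXACT modulo `hMo`: the `w = 2` residual leaf `SurfaceHuggingTowersTerminate` at all weights ⟺ at the wild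
weights. [folklore] -/
theorem surfaceLeaf_all_iff_atWildWeights (hMo : MaxContactCut.MonomialCornerAll) :
    (∀ n : ℕ, 1 ≤ n → SurfaceHuggingTowersTerminate n) ↔ NoSurfaceLeafTowersAtWildWeights :=
  noTower_nonMonomial_all_iff_wild (Q := fun T => ¬ CurveHugging T ∧ SurfaceHugging T)
    (powInvariant_curveHugging.not.and powInvariant_surfaceHugging).stable
    (monomialTowersTerminate_of_cornerAll hMo)

/-- EXACT modulo `hMo`: the never-monomial CONTACT leaf at all weights ⟺ at the wild weights. [folklore] -/
theorem nonMonomialContact_all_iff_atWildWeights (hMo : MaxContactCut.MonomialCornerAll) :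
    (∀ n : ℕ, 1 ≤ n → NonMonomialContactTowersTerminate n) ↔
      ∀ n : ℕ, 1 ≤ n → NoTowerWild n fun T => ¬ EventuallyMonomial T ∧ ContactHugging T :=
  noTower_nonMonomial_all_iff_wild powInvariant_contactHugging.stable (monomialTowersTerminate_of_cornerAll hMo)

/-- EXACT modulo `hMo`: the never-monomial NO-CONTACT leaf at all weights ⟺ at the wild weights. [folklore] -/
theorem nonMonomialWild_all_iff_atWildWeights (hMo : MaxContactCut.MonomialCornerAll) :
    (∀ n : ℕ, 1 ≤ n → NonMonomialWildTowersTerminate n) ↔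
      ∀ n : ℕ, 1 ≤ n → NoTowerWild n fun T => ¬ EventuallyMonomial T ∧ ¬ ContactHugging T :=
  noTower_nonMonomial_all_iff_wild powInvariant_contactHugging.not.stable
    (monomialTowersTerminate_of_cornerAll hMo)

/-! ### The root consumer with `hP hM h71` at the wild weights only -/

/-- **30253 `MaxContactCut.NoForcedTowers` BY NAME from the tree root `noForcedTowers_of_g47` (Theorems/PrincipalAxisCut, ten binders)
with `hP : ShadowPortAll`, `hM : MarkingPortAll`, `h71 : MaxContactCut.NoContactHuggingTowers` RESTRICTED TO THE WILD WEIGHTS `p ∣ n`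
(WEAKER by letter, EQUIVALENT by the marking-power bridge); the other seven verbatim.**  NOT a proof outright: all ten remain
hypotheses. [folklore] -/
theorem noForcedTowers_of_g49 (hMo : MaxContactCut.MonomialCornerAll)
    (hSL : MaxContactCut.SurfaceLawAll) (hH : MaxContactCut.NoHypersurfaceHuggingTowers) (hP : ShadowPortAtWildWeights)
    (hM : MarkingPortAtWildWeights) (h71 : NoContactHuggingTowersAtWildWeights)
    (hB : NoWildLatentFactorNonThreefoldMixedTowers)
    (hC4 : NoWildOccultDivisorialNonThreefoldMixedTowers) (hD4 : NoWildOccultNonDivisorialNonThreefoldMixedTowers)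
    (hNP : NoContactFreeNonPrincipalInLocusTowers) :
    MaxContactCut.NoForcedTowers :=
  noForcedTowers_of_g47 hMo hSL hH (shadowPortAll_iff_atWildWeights.mpr hP) (markingPortAll_iff_atWildWeights.mpr hM)
    (noContactHuggingTowers_iff_atWildWeights.mpr h71) hB hC4 hD4 hNP

/-- the same from the ABSOLUTE g43 located residual `NoWildOccultNonThreefoldMixedTowers` by name (nine binders). [folklore] -/
theorem noForcedTowers_of_g49_residual (hMo : MaxContactCut.MonomialCornerAll)
    (hSL : MaxContactCut.SurfaceLawAll) (hH : MaxContactCut.NoHypersurfaceHuggingTowers) (hP : ShadowPortAtWildWeights)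
    (hM : MarkingPortAtWildWeights) (h71 : NoContactHuggingTowersAtWildWeights)
    (hB : NoWildLatentFactorNonThreefoldMixedTowers) (hres : NoWildOccultNonThreefoldMixedTowers)
    (hNP : NoContactFreeNonPrincipalInLocusTowers) :
    MaxContactCut.NoForcedTowers :=
  noForcedTowers_of_g49 hMo hSL hH hP hM h71 hB hres.1 hres.2 hNP

/-- **The root at depth `J` (30253 by name)**: the root agenda with `h71` restricted to the weights with `p^J ∣ n`, every `J`.
[folklore] -/
theorem noForcedTowers_of_g49_deep (J : ℕ) (hMo : MaxContactCut.MonomialCornerAll)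
    (hSL : MaxContactCut.SurfaceLawAll) (hH : MaxContactCut.NoHypersurfaceHuggingTowers) (hP : ShadowPortAtWildWeights)
    (hM : MarkingPortAtWildWeights) (h71 : ∀ n : ℕ, 1 ≤ n → NoTowerDeep J n ContactHugging)
    (hB : NoWildLatentFactorNonThreefoldMixedTowers)
    (hC4 : NoWildOccultDivisorialNonThreefoldMixedTowers) (hD4 : NoWildOccultNonDivisorialNonThreefoldMixedTowers)
    (hNP : NoContactFreeNonPrincipalInLocusTowers) :
    MaxContactCut.NoForcedTowers :=
  noForcedTowers_of_g47 hMo hSL hH (shadowPortAll_iff_atWildWeights.mpr hP) (markingPortAll_iff_atWildWeights.mpr hM)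
    ((noContactHuggingTowers_iff_deep J).mpr h71) hB hC4 hD4 hNP

/-- **ADDENDUM — 30253 by name with FOUR binders at the wild weights**: `hH` too (modulo the binder `hMo`, used twice),
besides `hP hM h71`; `hMo hSL hB hC4 hD4 hNP` verbatim. [folklore] -/
theorem noForcedTowers_of_g49h (hMo : MaxContactCut.MonomialCornerAll)
    (hSL : MaxContactCut.SurfaceLawAll) (hH : NoHypersurfaceHuggingTowersAtWildWeights) (hP : ShadowPortAtWildWeights)
    (hM : MarkingPortAtWildWeights) (h71 : NoContactHuggingTowersAtWildWeights)
    (hB : NoWildLatentFactorNonThreefoldMixedTowers)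
    (hC4 : NoWildOccultDivisorialNonThreefoldMixedTowers) (hD4 : NoWildOccultNonDivisorialNonThreefoldMixedTowers)
    (hNP : NoContactFreeNonPrincipalInLocusTowers) :
    MaxContactCut.NoForcedTowers :=
  noForcedTowers_of_g49 hMo hSL ((noHypersurfaceHuggingTowers_iff_atWildWeights hMo).mpr hH) hP hM h71 hB hC4 hD4 hNP

end ByName

end Summit.ResolutionOfSingularities.ResolutionOfSingularities.Theorems.HugValuationCut
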